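import Summits.AtomisticToContinuum.HydrodynamicLimit.Theses.JParityClosure
import Summits.AtomisticToContinuum.HydrodynamicLimit.Theorems.PolynomialCompression.Negative.PdeForm
import Summits.AtomisticToContinuum.HydrodynamicLimit.Theorems.PolynomialCompression.Negative.Statics
import Literature.MathematicalPhysics.KineticTheory.HardSphereEulerDim

/-!
# The mollified empirical density of the crux `DensityCap`: atoms, Haar averages, the homogeneous witness

Negative-side structure for the crux `JParityClosure.DensityCap` (stmt-AtomisticToContinuum-13082), from the standing
disprover's `Cruxes/DensityCap/Disproof.lean` §0–§2 (cycle 1), landed so that the load-bearing / limit-order refutations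
(`Negative/Untied.lean`, `Negative/LimitOrder.lean`) and sibling seats can IMPORT it:
* vocabulary of the crux — the cone kernel `cone r x y = 3/(πr³)(1 − d(x,y)/r)₊`, the mollified empirical density
  `mollDensity r w x₀ = ∫ cone r q.1 x₀ ∂(empiricalMeasure w)`, the overshoot event `capEvent`, the conclusion block
  `CapLimit`; `densityCap_iff` (definitional);
* the HOMOGENEOUS WITNESS (flow families `PolynomialCompressionPDE.Flows` exist for `σ < 1/2`, Alexander): constant
  states are classical solutions, and
  `homogeneous_lln` — for the profiles `(1,1,0)` and `σ < σ₁ ≤ 1/2` the local Gibbs laws are probability measures whose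
  `t = 0` fields converge through every flow family to those of the constant state `(1,0,1)` (tree LLN
  `PolynomialCompressionPDE.lln_rhoLim`, `rhoLim ≡ 1` by `β ≡ 1` and `PolynomialCompressionStatics.integral_rhoLim_eq_one`);
* the GEOMETRIC CORE: `mollDensity_eq` (`n⁻¹ ∑ᵢ cone r xᵢ x₀`), `0 ≤ mollDensity ≤ 3/(πr³)`, the ATOM
  `mollDensity r w (w i).1 ≥ n⁻¹·3/(πr³)` (`atom_le_mollDensity`), the Haar-average identity `∫ cone r y · = coneMass r`
  (`integral_cone`, translation invariance), `coneMass r ≥ 3/(16π)` for `r ≤ 1` (`coneMass_ge`), and the first-moment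
  lemma `exists_le_mollDensity`: every configuration of `n ≥ 1` points has a centre of mollified density `≥ 3/(16π)`.
refuter-cdisprove-stmt-AtomisticToContinuum-13082-0.
-/

noncomputable section

namespace Summit.AtomisticToContinuum.HydrodynamicLimit.Theorems.DensityCapNegative

open MeasureTheory Filter Set Topology
open scoped ENNReal
open Literature.MathematicalPhysics.KineticTheory Literature.Analysis.FluidPDE
open Literature.Analysis.FunctionSpaces
open Summit.AtomisticToContinuum.HydrodynamicLimit.Theses.JParityClosure
open Summit.AtomisticToContinuum.HydrodynamicLimit.Theorems.PolynomialCompressionPDE (Flows flows_nonempty)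

/-! ## §0 Vocabulary -/

/-- The cone kernel of the crux: `b_r(x, y) = 3/(π r³) · (1 − d(x,y)/r)₊`, `d` the minimal-image distance. -/
def cone (r : ℝ) (x y : T3) : ℝ :=
  3 / (Real.pi * r ^ 3) * max (1 - Torus.euclidDist x y / r) 0

/-- The `r`-mollified empirical density of a configuration `w` read at the centre `x₀`
(`(n)⁻¹ ∑ᵢ b_r(xᵢ, x₀)`, `mollDensity_eq`). -/
def mollDensity (r : ℝ) {n : ℕ} (w : Config n (Fin 3) T3) (x₀ : T3) : ℝ :=
  ∫ q, cone r q.1 x₀ ∂(empiricalMeasure w)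

/-- The overshoot event of the crux: at some `s ∈ [0, t]` and some centre `x` the mollified empirical density of
the time-`s` configuration exceeds `ρ s x + η`. -/
def capEvent {σ : ℝ} (Φ : Flows σ) (N : ℕ) (ρ : ℝ → T3 → ℝ) (t η r : ℝ) : Set (Config (N + 1) (Fin 3) T3) :=
  {z | ∃ s ∈ Icc 0 t, ∃ x : T3, ρ s x + η < mollDensity r ((Φ N).flow s z) x}

/-- The conclusion block of the crux ("`N → ∞` at fixed `r`, then `r → 0`"). -/
def CapLimit (σ : ℝ) (a₀ : T3 → ℝ) (u₀ : T3 → V3) (θ₀ : T3 → ℝ) (Φ : Flows σ) (ρ : ℝ → T3 → ℝ)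
    (t : ℝ) : Prop :=
  ∀ η δ : ℝ, 0 < η → 0 < δ → ∃ r₀ : ℝ, 0 < r₀ ∧ ∀ r : ℝ, 0 < r → r < r₀ → ∃ N₀ : ℕ, ∀ N : ℕ, N₀ ≤ N →
    localGibbsLaw σ a₀ u₀ θ₀ N (Φ N) (capEvent Φ N ρ t η r) ≤ ENNReal.ofReal δ

/-- `DensityCap`, restated on the vocabulary (definitional). -/
theorem densityCap_iff :
    DensityCap ↔ ∀ (a₀ θ₀ : T3 → ℝ) (u₀ : T3 → V3), Continuous a₀ → Continuous θ₀ → Continuous u₀ →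
      (∀ x, 0 < a₀ x) → (∀ x, 0 < θ₀ x) → ∃ σ₀ : ℝ, 0 < σ₀ ∧ ∀ σ : ℝ, 0 < σ → σ < σ₀ →
      ∀ (T : ℝ) (ρ θ : ℝ → T3 → ℝ) (u : ℝ → T3 → V3), IsHardSphereEulerSolution σ T ρ u θ →
      ∀ Φ : Flows σ, TendstoHydroFieldsAt (fun N => localGibbsLaw σ a₀ u₀ θ₀ N (Φ N)) Φ ρ u θ 0 →
      ∀ t ∈ Ico 0 T, CapLimit σ a₀ u₀ θ₀ Φ ρ t :=
  Iff.rfl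

/-! ## §1 The homogeneous witness -/

/-- Constant states are classical hard-sphere Euler solutions on every `[0, T)`, for every `σ`. -/
theorem constState_isSolution (σ T : ℝ) {c θc : ℝ} (hc : 0 < c) (hθ : 0 < θc) :
    IsHardSphereEulerSolution σ T (fun _ _ => c) (fun _ _ => 0) (fun _ _ => θc) :=
  isHardSphereEulerSolutionDim_three_iff.1
    (IsHardSphereEulerSolutionDim.const σ T (0 : EuclideanSpace ℝ (Fin 3)) hc hθ)

/-- **The homogeneous law of large numbers with identified limits.** For the constant profiles
`(a₀, θ₀, u₀) = (1, 1, 0)` there is `σ₁ ≤ 1/2` such that for `0 < σ < σ₁` the local Gibbs laws are probability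
measures and, through EVERY flow family, their `t = 0` empirical fields converge in probability to those of the
constant state `(1, 0, 1)` (tree LLN `lln_rhoLim`; `rhoLim ≡ 1` because `β ≡ 1` and `∫ rhoLim = 1`). -/
theorem homogeneous_lln :
    ∃ σ₁ : ℝ, 0 < σ₁ ∧ σ₁ ≤ 1 / 2 ∧ ∀ σ : ℝ, 0 < σ → σ < σ₁ → ∀ Φ : Flows σ,
      (∀ N, IsProbabilityMeasure (localGibbsLaw σ (fun _ => 1) (fun _ => 0) (fun _ => 1) N (Φ N))) ∧
      TendstoHydroFieldsAt (fun N => localGibbsLaw σ (fun _ => 1) (fun _ => 0) (fun _ => 1) N (Φ N)) Φ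
        (fun _ _ => 1) (fun _ _ => 0) (fun _ _ => 1) 0 := by
  have ha : Continuous (fun _ : T3 => (1 : ℝ)) := continuous_const
  have hu : Continuous (fun _ : T3 => (0 : V3)) := continuous_const
  obtain ⟨σ₁, hσ₁, hσ₁2, H⟩ := PolynomialCompressionPDE.lln_rhoLim (a₀ := fun _ => 1) (θ₀ := fun _ => 1)
    (u₀ := fun _ => 0) ha ha hu (fun _ => one_pos) (fun _ => one_pos)
  refine ⟨σ₁, hσ₁, hσ₁2, fun σ hσ hσ1 Φ => ?_⟩
  obtain ⟨hsd, -, HΦ⟩ := H σ hσ hσ1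
  obtain ⟨hprob, hT⟩ := HΦ Φ
  refine ⟨hprob, ?_⟩
  set P := profileOf (fun _ : T3 => (1 : ℝ)) ha (fun _ => one_pos) with hP
  have hconst : ∀ y, rhoLim P σ y = rhoLim P σ 0 := fun y => by simp only [rhoLim, hP, profileOf_β]
  have hone : rhoLim P σ 0 = 1 := by
    have h1 := PolynomialCompressionStatics.integral_rhoLim_eq_one hsd
    rw [show rhoLim P σ = fun _ => rhoLim P σ 0 from funext hconst] at h1
    simpa using h1
  have hfun : (fun (_ : ℝ) => rhoLim P σ) = fun _ _ => (1 : ℝ) := by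
    funext s y
    rw [hconst y, hone]
  rw [hfun] at hT
  exact hT

/-- A probability law gives the sure event mass `1 > δ`: the contradiction pattern of every refutation below. -/
theorem not_univ_le {Ω : Type*} [MeasurableSpace Ω] (P : Measure Ω) [IsProbabilityMeasure P] {δ : ℝ}
    (hδ : δ < 1) {S : Set Ω} (hS : S = univ) : ¬ P S ≤ ENNReal.ofReal δ := by
  rw [hS, measure_univ]
  intro h
  exact absurd (lt_of_le_of_lt h (ENNReal.ofReal_lt_one.2 hδ)) (lt_irrefl 1)

/-- A reduced density below two thresholds and below `1/2`. -/
theorem exists_sigma {σ₀ σ₁ : ℝ} (h0 : 0 < σ₀) (h1 : 0 < σ₁) (h12 : σ₁ ≤ 1 / 2) :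
    ∃ σ : ℝ, 0 < σ ∧ σ < σ₀ ∧ σ < σ₁ ∧ σ < 1 / 2 :=
  ⟨min σ₀ σ₁ / 2, by positivity, by linarith [min_le_left σ₀ σ₁], by linarith [min_le_right σ₀ σ₁],
    by linarith [min_le_right σ₀ σ₁]⟩

/-! ## §2 The geometric core: atoms and averages of the mollified density -/

/-- The cone kernel is nonnegative. -/
theorem cone_nonneg {r : ℝ} (hr : 0 < r) (x y : T3) : 0 ≤ cone r x y :=
  mul_nonneg (div_nonneg (by norm_num) (by positivity)) (le_max_right _ _)

/-- The cone kernel is at most its peak value `3/(π r³)`. -/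
theorem cone_le {r : ℝ} (hr : 0 < r) (x y : T3) : cone r x y ≤ 3 / (Real.pi * r ^ 3) := by
  unfold cone
  have hd : 0 ≤ Torus.euclidDist x y / r := div_nonneg (norm_nonneg _) hr.le
  have h1 : max (1 - Torus.euclidDist x y / r) 0 ≤ 1 := max_le (by linarith) zero_le_one
  have h0 : 0 ≤ 3 / (Real.pi * r ^ 3) := div_nonneg (by norm_num) (by positivity)
  calc 3 / (Real.pi * r ^ 3) * max (1 - Torus.euclidDist x y / r) 0 ≤ 3 / (Real.pi * r ^ 3) * 1 := by gcongr
    _ = 3 / (Real.pi * r ^ 3) := mul_one _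

/-- On the diagonal the cone kernel takes its peak value: an ATOM of the mollified density. -/
theorem cone_self (r : ℝ) (x : T3) : cone r x x = 3 / (Real.pi * r ^ 3) := by
  simp [cone]

/-- The mollified empirical density is the normalised sum of the cone kernels centred at the particles. -/
theorem mollDensity_eq (r : ℝ) {n : ℕ} (w : Config n (Fin 3) T3) (x₀ : T3) :
    mollDensity r w x₀ = (n : ℝ)⁻¹ * ∑ i, cone r (w i).1 x₀ := by
  unfold mollDensity
  rw [integral_empiricalMeasure]

/-- The mollified density is nonnegative. -/
theorem mollDensity_nonneg {r : ℝ} (hr : 0 < r) {n : ℕ} (w : Config n (Fin 3) T3) (x₀ : T3) :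
    0 ≤ mollDensity r w x₀ := by
  rw [mollDensity_eq]
  exact mul_nonneg (inv_nonneg.2 (Nat.cast_nonneg n)) (Finset.sum_nonneg fun i _ => cone_nonneg hr _ _)

/-- The mollified density is at most the peak value `3/(π r³)` (the trivial, `N`-uniform cap; useless as `r → 0`). -/
theorem mollDensity_le {r : ℝ} (hr : 0 < r) {n : ℕ} (w : Config n (Fin 3) T3) (x₀ : T3) :
    mollDensity r w x₀ ≤ 3 / (Real.pi * r ^ 3) := by
  rw [mollDensity_eq]
  rcases Nat.eq_zero_or_pos n with hn | hn
  · subst hn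
    simp only [Nat.cast_zero, inv_zero, zero_mul]
    exact div_nonneg (by norm_num) (by positivity)
  · calc (n : ℝ)⁻¹ * ∑ i, cone r (w i).1 x₀ ≤ (n : ℝ)⁻¹ * ∑ _i : Fin n, 3 / (Real.pi * r ^ 3) := by
          gcongr with i _
          exact cone_le hr _ _
      _ = 3 / (Real.pi * r ^ 3) := by
          rw [Finset.sum_const, Finset.card_univ, Fintype.card_fin, nsmul_eq_mul, ← mul_assoc,
            inv_mul_cancel₀ (by exact_mod_cast hn.ne'), one_mul]

/-- **The atom.** Read at the position of any particle, the mollified density of `n` particles is at least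
`n⁻¹ · 3/(π r³)`: at FIXED `n` it blows up as `r → 0` (this kills every "`r → 0` before / uniformly in `N`"
strengthening, §4). -/
theorem atom_le_mollDensity {r : ℝ} (hr : 0 < r) {n : ℕ} (w : Config n (Fin 3) T3) (i : Fin n) :
    (n : ℝ)⁻¹ * (3 / (Real.pi * r ^ 3)) ≤ mollDensity r w (w i).1 := by
  rw [mollDensity_eq]
  gcongr
  calc 3 / (Real.pi * r ^ 3) = cone r (w i).1 (w i).1 := (cone_self r _).symm
    _ ≤ ∑ j, cone r (w j).1 (w i).1 :=
        Finset.single_le_sum (f := fun j => cone r (w j).1 (w i).1) (fun j _ => cone_nonneg hr _ _)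
          (Finset.mem_univ i)

/-- The Haar average over the centre of one cone kernel (independent of the particle position, `integral_cone`). -/
def coneMass (r : ℝ) : ℝ :=
  ∫ w : T3, 3 / (Real.pi * r ^ 3) * max (1 - ‖Torus.reprSym w‖ / r) 0

/-- The radial profile of the cone kernel is measurable. -/
theorem measurable_coneProfile (r : ℝ) :
    Measurable fun w : T3 => 3 / (Real.pi * r ^ 3) * max (1 - ‖Torus.reprSym w‖ / r) 0 :=
  measurable_const.mul ((measurable_const.sub (Torus.measurable_reprSym.norm.div_const r)).max
    measurable_const)

/-- Translation invariance of the Haar measure: the centre-average of the cone kernel of a particle at `y` is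
`coneMass r`, whatever `y`. -/
theorem integral_cone (r : ℝ) (y : T3) : ∫ x₀, cone r y x₀ = coneMass r := by
  have hsym : ∀ x₀, cone r y x₀ =
      (fun w : T3 => 3 / (Real.pi * r ^ 3) * max (1 - ‖Torus.reprSym w‖ / r) 0) (x₀ - y) := by
    intro x₀
    show 3 / (Real.pi * r ^ 3) * max (1 - Torus.euclidDist y x₀ / r) 0 = _
    rw [Torus.euclidDist_comm, Torus.euclidDist_eq]
  simp_rw [hsym]
  exact integral_sub_right_eq_self (μ := (volume : Measure T3))
    (fun w : T3 => 3 / (Real.pi * r ^ 3) * max (1 - ‖Torus.reprSym w‖ / r) 0) y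

/-- In the box `‖wᵢ‖ ≤ r/4` the minimal-image norm is at most `r/2`. -/
theorem norm_reprSym_le_of_box {r : ℝ} (hr : 0 < r) {w : T3} (hw : ∀ i, ‖w i‖ ≤ r / 4) :
    ‖Torus.reprSym w‖ ≤ r / 2 := by
  rw [norm_reprSym_eq_sqrt]
  have hsum : ∑ i, ‖w i‖ ^ 2 ≤ (r / 2) ^ 2 := by
    calc ∑ i, ‖w i‖ ^ 2 ≤ ∑ _i : Fin 3, (r / 4) ^ 2 := by
          gcongr with i _
          exact hw i
      _ = 3 * (r / 4) ^ 2 := by simp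
      _ ≤ (r / 2) ^ 2 := by nlinarith
  calc Real.sqrt (∑ i, ‖w i‖ ^ 2) ≤ Real.sqrt ((r / 2) ^ 2) := Real.sqrt_le_sqrt hsum
    _ = r / 2 := Real.sqrt_sq (by linarith)

/-- **The cone mass is bounded below by an absolute constant**: `coneMass r ≥ 3/(16π)` for `0 < r ≤ 1`
(the kernel is `≥ (1/2)·3/(πr³)` on the box `‖wᵢ‖ ≤ r/4`, of Haar volume `(r/2)³`). (In fact `coneMass r = 1`
for `r ≤ 1/2` — the kernel is a probability density — but the crude bound is all that is used.) -/
theorem coneMass_ge {r : ℝ} (hr : 0 < r) (hr1 : r ≤ 1) : 3 / (16 * Real.pi) ≤ coneMass r := by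
  set B : Set T3 := Set.pi Set.univ fun _ => Metric.closedBall (0 : UnitAddCircle) (r / 4) with hB
  have hBm : MeasurableSet B := MeasurableSet.univ_pi fun _ => Metric.isClosed_closedBall.measurableSet
  have hvol : volume B = ENNReal.ofReal ((r / 2) ^ 3) := by
    rw [hB, volume_pi_pi]
    simp only [AddCircle.volume_closedBall, Finset.prod_const, Finset.card_univ, Fintype.card_fin]
    rw [min_eq_right (by linarith), ← ENNReal.ofReal_pow (by linarith)]
    congr 1
    ring
  have hpi : 0 < Real.pi := Real.pi_pos
  have hc0 : 0 ≤ 3 / (Real.pi * r ^ 3) := div_nonneg (by norm_num) (by positivity)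
  have hpt : ∀ w : T3, B.indicator (fun _ => 3 / (2 * Real.pi * r ^ 3)) w ≤
      3 / (Real.pi * r ^ 3) * max (1 - ‖Torus.reprSym w‖ / r) 0 := by
    intro w
    by_cases hw : w ∈ B
    · rw [Set.indicator_of_mem hw]
      have hwi : ∀ i, ‖w i‖ ≤ r / 4 := fun i => by
        have := hw i (Set.mem_univ i)
        rwa [Metric.mem_closedBall, dist_zero_right] at this
      have hn := norm_reprSym_le_of_box hr hwi
      have hhalf : (1 : ℝ) / 2 ≤ max (1 - ‖Torus.reprSym w‖ / r) 0 := by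
        refine le_trans ?_ (le_max_left _ _)
        rw [le_sub_comm, div_le_iff₀ hr]
        linarith
      calc 3 / (2 * Real.pi * r ^ 3) = 3 / (Real.pi * r ^ 3) * (1 / 2) := by
            field_simp
        _ ≤ 3 / (Real.pi * r ^ 3) * max (1 - ‖Torus.reprSym w‖ / r) 0 := by gcongr
    · rw [Set.indicator_of_notMem hw]
      exact mul_nonneg hc0 (le_max_right _ _)
  have hint : Integrable (fun w : T3 => 3 / (Real.pi * r ^ 3) * max (1 - ‖Torus.reprSym w‖ / r) 0) volume := by
    refine Integrable.of_bound (measurable_coneProfile r).aestronglyMeasurable (3 / (Real.pi * r ^ 3))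
      (ae_of_all _ fun w => ?_)
    rw [Real.norm_eq_abs, abs_of_nonneg (mul_nonneg hc0 (le_max_right _ _))]
    have h1 : max (1 - ‖Torus.reprSym w‖ / r) 0 ≤ 1 :=
      max_le (by linarith [div_nonneg (norm_nonneg (Torus.reprSym w)) hr.le]) zero_le_one
    calc 3 / (Real.pi * r ^ 3) * max (1 - ‖Torus.reprSym w‖ / r) 0 ≤ 3 / (Real.pi * r ^ 3) * 1 := by gcongr
      _ = _ := mul_one _
  calc 3 / (16 * Real.pi) = (volume B).toReal * (3 / (2 * Real.pi * r ^ 3)) := by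
        rw [hvol, ENNReal.toReal_ofReal (by positivity)]
        field_simp
        ring
    _ = ∫ w, B.indicator (fun _ => 3 / (2 * Real.pi * r ^ 3)) w := by
        rw [integral_indicator hBm, setIntegral_const, smul_eq_mul, measureReal_def]
    _ ≤ coneMass r := integral_mono ((integrable_const _).indicator hBm) hint hpt

/-- **Every configuration has a centre of mollified density at least `3/(16π)`** (`0 < r ≤ 1`, `n ≥ 1` particles):
the Haar average of `x₀ ↦ mollDensity r w x₀` is `coneMass r ≥ 3/(16π)` and some point is above average
(first-moment method). This is what makes a DENSITY that is not tied to the data, or not transported by the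
continuity equation, refutable (§3). -/
theorem exists_le_mollDensity {r : ℝ} (hr : 0 < r) (hr1 : r ≤ 1) {n : ℕ} (hn : n ≠ 0)
    (w : Config n (Fin 3) T3) : ∃ x₀ : T3, 3 / (16 * Real.pi) ≤ mollDensity r w x₀ := by
  have hci : ∀ i : Fin n, Integrable (fun x₀ : T3 => cone r (w i).1 x₀) volume := by
    intro i
    have hmeas : Measurable fun x₀ : T3 => cone r (w i).1 x₀ := by
      have : (fun x₀ : T3 => cone r (w i).1 x₀) =
          (fun v : T3 => 3 / (Real.pi * r ^ 3) * max (1 - ‖Torus.reprSym v‖ / r) 0) ∘ fun x₀ => (w i).1 - x₀ := by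
        funext x₀
        rfl
      rw [this]
      exact (measurable_coneProfile r).comp (measurable_const.sub measurable_id)
    refine Integrable.of_bound hmeas.aestronglyMeasurable (3 / (Real.pi * r ^ 3)) (ae_of_all _ fun x₀ => ?_)
    rw [Real.norm_eq_abs, abs_of_nonneg (cone_nonneg hr _ _)]
    exact cone_le hr _ _
  have hmi : Integrable (fun x₀ : T3 => mollDensity r w x₀) volume := by
    have : (fun x₀ : T3 => mollDensity r w x₀) = fun x₀ => (n : ℝ)⁻¹ * ∑ i, cone r (w i).1 x₀ :=
      funext fun x₀ => mollDensity_eq r w x₀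
    rw [this]
    exact (integrable_finsetSum _ fun i _ => hci i).const_mul _
  have havg : ∫ x₀, mollDensity r w x₀ = coneMass r := by
    simp_rw [mollDensity_eq]
    rw [integral_const_mul, integral_finsetSum _ fun i _ => hci i]
    simp_rw [integral_cone]
    rw [Finset.sum_const, Finset.card_univ, Fintype.card_fin, nsmul_eq_mul, ← mul_assoc,
      inv_mul_cancel₀ (by exact_mod_cast hn), one_mul]
  obtain ⟨x₀, hx₀⟩ := exists_integral_le hmi
  exact ⟨x₀, (coneMass_ge hr hr1).trans (havg ▸ hx₀)⟩

end Summit.AtomisticToContinuum.HydrodynamicLimit.Theorems.DensityCapNegative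

end
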